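import Literature.MathematicalPhysics.QuantumFieldTheory.Balaban1983to89.B9Thm314GpFlatMultiLevelTorus
import Literature.MathematicalPhysics.QuantumFieldTheory.Balaban1983to89.B6Prop22HolderMultiLevelTorus

/-!
# `Balaban1983to89.B9Thm314GpFlatHolder` — [B9] THEOREM 3.14 (pp. 426–427, (3.154)) AT `U = 1` ON THE GENUINE `k`-LEVEL
TORUS: THE HÖLDER ENTRY [4] (2.67)₄ = [B9] (3.43)₁ OF THE SCALAR PROPAGATOR `G′ = Δ′_a⁻¹` — for two nested families `{Ω_j}`,
`{Ω′_j}` on one torus, `Ω = Ω_k ∩ Ω′_k`, a common top block `B^k(y) ∋ x, x′`, `supp λ ⊂ B^k(y′)`, `0 ≤ α < 1`: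
`|x − x′|^{−α}·|(∇_μ(G′[Ω] − G′[Ω′])λ)(x′) − (∇_μ(G′[Ω] − G′[Ω′])λ)(x)| ≤ C·(L^k)^{1−α}·e^{−δ·min(d_Ω,d_Ω′)(y,y′)}·e^{−δ·d(y,y′,Ω)}·|λ|`,
through a LINEAR-FUNCTIONAL form of the resolvent estimate of file 2 (no existing module is touched; no fact is minted)

FRAMING (verbatim cell line):
statement-level skeleton of published theorems with citation tags; proofs where landed; nothing here is a claim about the Yang–Mills mass gap

Sources under audit (cell pub-balaban / lit-balaban): T. Bałaban, *Propagators for lattice gauge theories in a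
background field*, Commun. Math. Phys. **99** (1985) 389–434 [`Balaban1985BackgroundPropagators`, "B9"], pp. 426–427
[PDF 38–39] (Theorem 3.14, (3.154)), p. 398 (3.43) (held text `paper:balaban1985-cmp99-background-propagators`
p0010/p0038/p0039, read this generation); T. Bałaban, *Propagators and renormalization transformations for lattice gauge
theories. II*, Commun. Math. Phys. **96** (1984) 223–250 [`Balaban1984PropagatorsII`, "[4]"], Prop. 2.2 (2.67) p. 234
(fourth entry).  Unit `lit-balaban-p21` (Phase-2 proof seat p21 gen 18, HOME `run/shared/lean/pub/lit-balaban/`,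
free-target protocol G.5-34(d); B9 fold owner r06, B6 fold owner r03, referee ref-4).

## WHAT IS PRINTED

B9 Theorem 3.14 (p. 427): «If we take a pair of operators constructed for the two sequences {Ω_j}, {Ω′_j}, then their
difference satisfies all the inequalities characteristic for operators of the considered type, with the additional factor
exp(−δ₀d(y, y′, Ω)) … (3.154) on the right-hand sides.»  Among the characteristic inequalities of `G′` (Theorem 3.1,
pp. 397–398) are the Hölder members (3.43): «‖ζ∇_UG′(U)λ‖_β, … ≤ B₀(β)(Lʲη)^{1−β}e^{−δ₀d(y,y′)}|λ|, β₀ < 1, ζ ∈ C₀^∞(Δ̃(y)),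
y ∈ Λ_j, supp λ ⊂ Δ(y′)» = [4] (2.67) p. 234, fourth entry: the Hölder quotient of `∇G′λ` over `x, x′ ∈ B^j(y)` is
`≤ O(1)(Lʲη)^{1−α}e^{−δ₀d(y,y′)}|λ|`.

## WHAT THIS FILE CERTIFIES (kernel-checked; lattice units; setting of files 1–3 `B9Thm314GpFlat…`)

* §1 `abs_fun_le_sum`, **`fun_resolvent_bound`** — the block decomposition and the resolvent estimate of file 2 for an
  arbitrary LINEAR FUNCTIONAL `φ` of the outer vector with a block bound `|φμ| ≤ K_L·e^{−δd(y,b)}·B` (`supp μ ⊂ B(b)`,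
  `|μ| ≤ B`) in place of the row `x` of `A_L·G′[D]`:
  `|φ((Δ′[D′] − Δ′[D])·G′[D′]A_Rλ)| ≤ K_L·(2C_Ra₊L²e^{(3/2)δ}c)·(L^{mk}/L^{2k})·e^{−½δ·d(y,y′,Ω)}·B` (same proof: file 2's
  `abs_pert_le_Ublk`, `block_term_le`, (2.61)).
* §2 `quadFun` — the Hölder functional `u ↦ |x′−x|_T^{−α}·[((Gu)(x′+e_μ) − (Gu)(x′)) − ((Gu)(x+e_μ) − (Gu)(x))]`;
  **`thm314_dGp_holder_flat_multiLevelTorus`** — for `0 ≤ α < 1` there are `δ, C, M₀ > 0`, `N₀ ≥ 1` (`k`-uniform, uniform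
  in `μ`, independent of the two families) such that for all admissible `k, M_h, R, P`, every two torus families `D, D′`,
  windowed weights, common top blocks `y ∋ x, x′` (`x ≠ x′`) and `y′ ⊃ supp λ` (`|λ| ≤ B`):
  `|x′−x|_T^{−α}·|(∇_μ(G′[D] − G′[D′])λ)(x′) − (∇_μ(G′[D] − G′[D′])λ)(x)| ≤ C·(L^k)^{1−α}·e^{−δ·min(d_D,d_{D′})(y,y′)}·e^{−δ·d(y,y′,Ω)}·B`
  — inputs BY NAME: the torus Hölder entry `B6Prop22HolderMultiLevelTorus.prop22_fourth_multiLevelTorus` for BOTH families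
  (trivial bound, and the block bound of `quadFun` on `G′[D]`), the torus (2.67)₁ `prop22_first_multiLevelTorus` for the
  inner factor `G′[D′]`, file 1's resolvent identity, file 3's `combined_bound`/`consts_260_261`/`weights_repair`.

## HONEST SCOPE

* `U = 1` only, the operator `G′` only, the Hölder member of `∇G′` only ([4] (2.67)₄; B9 (3.43) first member, with B9's
  `ζ`-localised Hölder norm read as the Hölder quotient over two points of one block, as in the torus lineage); not the
  dual Hölder member `G′∇*` ((2.67)₅), not the `L²` members, not the other operators.  Torus lineage setting (`Ω₁ = T_η`,
  levels `1 … k`, `A = 0`, `m² = 0`, lattice units, `P_μ ≥ 4`); (3.154) = file 1's `dOmega`; the characteristic factor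
  carries `min(d_D, d_{D′})`; constants depend on `α`.  A different (resolvent) proof of the printed statement on a model
  family, declared; nothing is inferred from the manuscript: every step is kernel-checked; the quoted sentences locate the
  statements.
-/

namespace Literature.MathematicalPhysics.QuantumFieldTheory.Balaban1983to89.B9Thm314GpFlatHolder

open Finset Matrix
open Literature.MathematicalPhysics.QuantumFieldTheory.Balaban1983to89.B4Reflection242 (boxDom mem_boxDom blk)
open Literature.MathematicalPhysics.QuantumFieldTheory.Balaban1983to89.B4TorusKernel.MultiPeriod (torusSupNorm
  torusSupNorm_nonneg)
open Literature.MathematicalPhysics.QuantumFieldTheory.Balaban1983to89.B6MultiLevelBoxOperator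
open Literature.MathematicalPhysics.QuantumFieldTheory.Balaban1983to89.B6MultiLevelTorusOperator
open Literature.MathematicalPhysics.QuantumFieldTheory.Balaban1983to89.B6Geom246MultiLevelBox
open Literature.MathematicalPhysics.QuantumFieldTheory.Balaban1983to89.B6Geom246MultiLevelTorus
open Literature.MathematicalPhysics.QuantumFieldTheory.Balaban1983to89.B6Prop22MultiLevelTorus (prop22_first_multiLevelTorus)
open Literature.MathematicalPhysics.QuantumFieldTheory.Balaban1983to89.B6Prop22HolderMultiLevelTorus
  (prop22_fourth_multiLevelTorus)
open Literature.MathematicalPhysics.QuantumFieldTheory.Balaban1983to89.B6RandomWalk (HasMajorant BlockSupp blockPiece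
  sum_blockPiece)
open Literature.MathematicalPhysics.QuantumFieldTheory.Balaban1983to89.B6Ineq243TwoLevelBox (aNext)
open Literature.MathematicalPhysics.QuantumFieldTheory.Balaban1983to89.B6Lemma21Repaired (Ineq261With)
open Literature.MathematicalPhysics.QuantumFieldTheory.Balaban1983to89.B9Thm314GpFlatTorusGeometry
open Literature.MathematicalPhysics.QuantumFieldTheory.Balaban1983to89.B9Thm314GpFlatResolvent
open Literature.MathematicalPhysics.QuantumFieldTheory.Balaban1983to89.B9Thm314GpFlatMultiLevelTorus

noncomputable section

variable {d : ℕ}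

/-! ## §1 The resolvent estimate for a linear functional of the outer vector -/

section Functional

variable {g : B6.Geometry} {X : Type}

/-- **`|φ(f)| ≤ Σ_b K(b)·U(b)`** for a linear functional with block bounds `|φμ| ≤ K(b)·B` (`supp μ ⊂ B(b)`, `|μ| ≤ B`) and
ANY vector `f` with `|f| ≤ U(b)` on `B(b)` (the decomposition `f = Σ_b Δ(b)f` of (2.52)). [cite: Balaban1984PropagatorsII, (2.51)–(2.52) p.232, dictionary] -/
theorem abs_fun_le_sum (blk : X → g.Site) (φ : (X → ℝ) →ₗ[ℝ] ℝ) {K : g.Site → ℝ}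
    (hφ : ∀ (b : g.Site) (u : X → ℝ) (Bu : ℝ), BlockSupp blk u b Bu → |φ u| ≤ K b * Bu) (f : X → ℝ) (U : g.Site → ℝ)
    (hU0 : ∀ b, 0 ≤ U b) (hU : ∀ z, |f z| ≤ U (blk z)) : |φ f| ≤ ∑ b, K b * U b := by
  classical
  have hf : f = ∑ b, blockPiece blk b f := (sum_blockPiece blk f).symm
  have hpiece : ∀ b, BlockSupp blk (blockPiece blk b f) b (U b) := fun b =>
    { nonneg := hU0 b
      bound := fun z hz => by
        simp only [blockPiece, hz, if_true]
        exact hz ▸ hU z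
      off := fun z hz => by simp only [blockPiece, hz, if_false] }
  have hφf : φ f = ∑ b, φ (blockPiece blk b f) := by
    conv_lhs => rw [hf]
    rw [map_sum]
  calc |φ f| = |∑ b, φ (blockPiece blk b f)| := by rw [hφf]
    _ ≤ ∑ b, |φ (blockPiece blk b f)| := Finset.abs_sum_le_sum_abs _ _
    _ ≤ ∑ b, K b * U b := Finset.sum_le_sum fun b _ => hφ b _ _ (hpiece b)

end Functional

section Resolvent

variable {ℓ Mh k R : ℕ} {P : Fin (d + 1) → ℕ} (D D' : TDomains d ℓ Mh k P R)

/-- **THE RESOLVENT ESTIMATE FOR A LINEAR FUNCTIONAL** of the outer vector (the Hölder members need it: the Hölder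
quotient at two points of a block is a functional, not a row): with a block bound `|φμ| ≤ K_L·e^{−δd(y,b)}·B` at the top
block `y` of `𝔅[D]`, the inner majorant of `G′[D′]·A_R` (weight `C_R·L^{mj}`), (2.61) at `¼δ` and the (2.60)-threshold,
`|φ((Δ′[D′] − Δ′[D])G′[D′]A_Rλ)| ≤ K_L·(2C_Ra₊L²e^{(3/2)δ}c)·(L^{mk}/L^{2k})·e^{−½δ·d(y,y′,Ω)}·B`.
[cite: Balaban1985BackgroundPropagators, Thm 3.14 (3.154) pp.426–427; Balaban1984PropagatorsII, (2.67) p.234, (2.60)–(2.61) p.234] -/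
theorem fun_resolvent_bound (hMh : 1 ≤ Mh) (hP : ∀ μ, 1 ≤ P μ) (hRM : 1 ≤ R * ((ℓ + 1) * Mh))
    {a : ℕ → ℝ} {aplus : ℝ} (ha0 : ∀ j, 0 ≤ a j) (hap : ∀ j, a j ≤ aplus) (m : ℕ)
    (AR : Matrix ↥(boxDom (N0 ℓ Mh k P)) ↥(boxDom (N0 ℓ Mh k P)) ℝ) {KL CR δ c : ℝ} (hCR : 0 ≤ CR) (hδ : 0 ≤ δ)
    (φ : (↥(boxDom (N0 ℓ Mh k P)) → ℝ) →ₗ[ℝ] ℝ) {y : ↥(bset D.toDomains)} (hy : y.1.1 = k) (hKL : 0 ≤ KL)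
    (hφ : ∀ (b : ↥(bset D.toDomains)) (u : ↥(boxDom (N0 ℓ Mh k P)) → ℝ) (Bu : ℝ),
      BlockSupp (g := geomT D) (blkOf D.toDomains) u b Bu → |φ u| ≤ KL * Real.exp (-(δ * (geomT D).dist y b)) * Bu)
    (hR : HasMajorant (g := geomT D') (blkOf D'.toDomains) (Matrix.toLin' (gmlT (N0 ℓ Mh k P) ℓ k D'.lev a * AR))
      (fun y y' => CR * ((ℓ : ℝ) + 1) ^ (m * y.1.1) * Real.exp (-(δ * (geomT D').dist y y'))))
    (h261 : Ineq261With c (geomT D) δ (1 / 4))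
    (hthr : ((ℓ : ℝ) + 1) ^ 2 ≤ Real.exp (1 / 4 * δ * ((R : ℝ) * (((ℓ : ℝ) + 1) * Mh) - 1)))
    {y' : ↥(bset D'.toDomains)} (hy' : y'.1.1 = k)
    {μv : ↥(boxDom (N0 ℓ Mh k P)) → ℝ} {B : ℝ} (hμ : BlockSupp (g := geomT D') (blkOf D'.toDomains) μv y' B) :
    |φ (diffM D D' a *ᵥ ((gmlT (N0 ℓ Mh k P) ℓ k D'.lev a * AR) *ᵥ μv))|
      ≤ KL * (2 * CR * aplus * ((ℓ : ℝ) + 1) ^ 2 * Real.exp (3 / 2 * δ) * c)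
        * (((ℓ : ℝ) + 1) ^ (m * k) / ((ℓ : ℝ) + 1) ^ (2 * k))
        * Real.exp (-(1 / 2 * δ * dOmega D D' y.1.2 y'.1.2)) * B := by
  classical
  have hB : 0 ≤ B := hμ.nonneg
  have hap0 : 0 ≤ aplus := (ha0 0).trans (hap 0)
  -- STEP 1: the inner vector and its (2.67) majorant
  have hvz : ∀ z, |((gmlT (N0 ℓ Mh k P) ℓ k D'.lev a * AR) *ᵥ μv) z|
      ≤ CR * ((ℓ : ℝ) + 1) ^ (m * D'.lev z.1) * Eprof D' δ y' (blkOf D'.toDomains z) * B := by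
    intro z
    have h := hR y' μv B hμ z
    rw [Matrix.toLin'_apply] at h
    exact h
  -- STEP 2: the perturbed vector
  have huz := abs_pert_le_Ublk D D' m ha0 hap hCR hB y' hvz
  -- STEP 3: the functional by the block decomposition
  have hφu := abs_fun_le_sum (g := geomT D) (blkOf D.toDomains) φ hφ
    (diffM D D' a *ᵥ ((gmlT (N0 ℓ Mh k P) ℓ k D'.lev a * AR) *ᵥ μv)) (Ublk D D' m δ aplus CR B y')
    (Ublk_nonneg D D' m hap0 hCR hB y') huz
  refine hφu.trans ?_
  -- STEPS 4–5: block terms and the (2.61) sum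
  have hsum : ∑ b : ↥(bset D.toDomains), Real.exp (-(1 / 4 * δ * (geomT D).dist y b)) ≤ c := h261 y
  calc ∑ b, KL * Real.exp (-(δ * (geomT D).dist y b)) * Ublk D D' m δ aplus CR B y' b
      ≤ ∑ b, KL * (aplus * (CR * B))
          * (2 * ((ℓ : ℝ) + 1) ^ 2 * Real.exp (3 / 2 * δ) * (((ℓ : ℝ) + 1) ^ (m * k) / ((ℓ : ℝ) + 1) ^ (2 * k))
            * Real.exp (-(1 / 2 * δ * dOmega D D' y.1.2 y'.1.2)))
          * Real.exp (-(1 / 4 * δ * (geomT D).dist y b)) :=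
        Finset.sum_le_sum fun b _ => block_term_le D D' hMh hP hRM m hKL hap0 hCR hδ hB hthr hy hy' b
    _ = KL * (aplus * (CR * B))
          * (2 * ((ℓ : ℝ) + 1) ^ 2 * Real.exp (3 / 2 * δ) * (((ℓ : ℝ) + 1) ^ (m * k) / ((ℓ : ℝ) + 1) ^ (2 * k))
            * Real.exp (-(1 / 2 * δ * dOmega D D' y.1.2 y'.1.2)))
          * ∑ b, Real.exp (-(1 / 4 * δ * (geomT D).dist y b)) := by rw [Finset.mul_sum]
    _ ≤ KL * (aplus * (CR * B))
          * (2 * ((ℓ : ℝ) + 1) ^ 2 * Real.exp (3 / 2 * δ) * (((ℓ : ℝ) + 1) ^ (m * k) / ((ℓ : ℝ) + 1) ^ (2 * k))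
            * Real.exp (-(1 / 2 * δ * dOmega D D' y.1.2 y'.1.2)))
          * c := mul_le_mul_of_nonneg_left hsum (by positivity)
    _ = _ := by ring

end Resolvent

/-! ## §2 The Hölder entry [4] (2.67)₄ for the difference `G′[D] − G′[D′]` -/

section Holder

variable {ℓ Mh k R : ℕ} {P : Fin (d + 1) → ℕ}

/-- the HÖLDER FUNCTIONAL of the torus lineage at two sites `x, x′` and a direction `μ`, with a scalar prefactor `c`
(`= |x′−x|_T^{−α}`): `u ↦ c·[((Gu)(x′+e_μ) − (Gu)(x′)) − ((Gu)(x+e_μ) − (Gu)(x))]`.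
[cite: Balaban1984PropagatorsII, (2.67) p.234 (fourth entry), dictionary] -/
def quadFun (N : Fin (d + 1) → ℕ) (G : Matrix ↥(boxDom N) ↥(boxDom N) ℝ) (μ : Fin (d + 1)) (x x' : ↥(boxDom N)) (c : ℝ) :
    (↥(boxDom N) → ℝ) →ₗ[ℝ] ℝ where
  toFun u := c * (((G *ᵥ u) (tshift N (unitVec μ) x') - (G *ᵥ u) x') - ((G *ᵥ u) (tshift N (unitVec μ) x) - (G *ᵥ u) x))
  map_add' u v := by
    simp only [Matrix.mulVec_add, Pi.add_apply]
    ring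
  map_smul' r u := by
    simp only [Matrix.mulVec_smul, Pi.smul_apply, smul_eq_mul, RingHom.id_apply]
    ring

/-- unfolding `quadFun`. [cite: Balaban1984PropagatorsII, (2.67) p.234 (fourth entry), dictionary] -/
theorem quadFun_apply (N : Fin (d + 1) → ℕ) (G : Matrix ↥(boxDom N) ↥(boxDom N) ℝ) (μ : Fin (d + 1))
    (x x' : ↥(boxDom N)) (c : ℝ) (u : ↥(boxDom N) → ℝ) :
    quadFun N G μ x x' c u
      = c * (((G *ᵥ u) (tshift N (unitVec μ) x') - (G *ᵥ u) x') - ((G *ᵥ u) (tshift N (unitVec μ) x) - (G *ᵥ u) x)) :=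
  rfl

/-- `|quadFun … c u| = c·|…|` for `c ≥ 0`. [cite: Balaban1984PropagatorsII, (2.67) p.234 (fourth entry), dictionary] -/
theorem abs_quadFun (N : Fin (d + 1) → ℕ) (G : Matrix ↥(boxDom N) ↥(boxDom N) ℝ) (μ : Fin (d + 1))
    (x x' : ↥(boxDom N)) {c : ℝ} (hc : 0 ≤ c) (u : ↥(boxDom N) → ℝ) :
    |quadFun N G μ x x' c u|
      = c * |((G *ᵥ u) (tshift N (unitVec μ) x') - (G *ᵥ u) x') - ((G *ᵥ u) (tshift N (unitVec μ) x) - (G *ᵥ u) x)| := by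
  rw [quadFun_apply, abs_mul, abs_of_nonneg hc]

set_option maxHeartbeats 800000 in
/-- **THEOREM 3.14 AT `U = 1`, THE HÖLDER ENTRY [4] (2.67)₄ = [B9] (3.43)₁ (`∇G′`, Hölder quotient)**: for `0 ≤ α < 1`, two
torus families, a common top block `y ∋ x, x′` and `y′ ⊃ supp λ`:
`|x′−x|_T^{−α}·|(∇_μ(G′[D] − G′[D′])λ)(x′) − (∇_μ(G′[D] − G′[D′])λ)(x)| ≤ C·(L^k)^{1−α}·e^{−δ·min(d_D,d_{D′})(y,y′)}·e^{−δ·d(y,y′,Ω)}·B`,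
constants `k`-uniform, uniform in `μ`, depending on `α`. [cite: Balaban1985BackgroundPropagators, Thm 3.14 (3.154) pp.426–427, (3.43) p.398; Balaban1984PropagatorsII, Prop. 2.2 (2.67) p.234 (fourth entry)] -/
theorem thm314_dGp_holder_flat_multiLevelTorus (d ℓ : ℕ) (hℓ : 1 ≤ ℓ) (aminus aplus a2minus a2plus : ℝ)
    (ha : 0 < aminus) (ha2 : 0 < a2minus) (α : ℝ) (hα0 : 0 ≤ α) (hα1 : α < 1) :
    ∃ δ C M₀ : ℝ, ∃ N₀ : ℕ, 0 < δ ∧ 0 < C ∧ 0 < M₀ ∧ 0 < N₀ ∧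
      ∀ (k Mh R : ℕ), 3 ≤ Mh → M₀ ≤ ((ℓ : ℝ) + 1) * Mh → 2 * (ℓ + 1) ≤ R → N₀ + 1 ≤ R * ((ℓ + 1) * Mh) →
      ∀ (P : Fin (d + 1) → ℕ) (hP : ∀ μ, 1 ≤ P μ) (hP4 : ∀ μ, 4 ≤ P μ) (D D' : TDomains d ℓ Mh k P R)
        (a c : ℕ → ℝ), (∀ i, 1 ≤ i → aminus ≤ a i ∧ a i ≤ aplus) → (∀ i, 1 ≤ i → a2minus ≤ c i ∧ c i ≤ a2plus) →
        (∀ i, 1 ≤ i → a (i + 1) = aNext ℓ (a i) (c i)) →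
      ∀ (p q : ℕ × (Fin (d + 1) → ℤ)) (hpD : p ∈ bset D.toDomains) (hpD' : p ∈ bset D'.toDomains)
        (hqD : q ∈ bset D.toDomains) (hqD' : q ∈ bset D'.toDomains), p.1 = k → q.1 = k →
      ∀ (lam : ↥(boxDom (N0 ℓ Mh k P)) → ℝ) (B : ℝ),
        BlockSupp (g := geomT D) (blkOf D.toDomains) lam ⟨q, hqD⟩ B →
      ∀ (μ : Fin (d + 1)) (x x' : ↥(boxDom (N0 ℓ Mh k P))), x'.1 ≠ x.1 →
        blkOf D.toDomains x = ⟨p, hpD⟩ → blkOf D.toDomains x' = ⟨p, hpD⟩ →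
        (torusSupNorm (N0 ℓ Mh k P) (x'.1 - x.1)) ^ (-α)
            * |(((gmlT (N0 ℓ Mh k P) ℓ k D.lev a - gmlT (N0 ℓ Mh k P) ℓ k D'.lev a) *ᵥ lam)
                  (tshift (N0 ℓ Mh k P) (unitVec μ) x')
                - ((gmlT (N0 ℓ Mh k P) ℓ k D.lev a - gmlT (N0 ℓ Mh k P) ℓ k D'.lev a) *ᵥ lam) x'
                - (((gmlT (N0 ℓ Mh k P) ℓ k D.lev a - gmlT (N0 ℓ Mh k P) ℓ k D'.lev a) *ᵥ lam)
                    (tshift (N0 ℓ Mh k P) (unitVec μ) x)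
                  - ((gmlT (N0 ℓ Mh k P) ℓ k D.lev a - gmlT (N0 ℓ Mh k P) ℓ k D'.lev a) *ᵥ lam) x))|
          ≤ C * (((ℓ : ℝ) + 1) ^ k) ^ (1 - α)
              * Real.exp (-(δ * min ((geomT D).dist ⟨p, hpD⟩ ⟨q, hqD⟩) ((geomT D').dist ⟨p, hpD'⟩ ⟨q, hqD'⟩)))
              * Real.exp (-(δ * dOmega D D' p.2 q.2)) * B := by
  obtain ⟨δ₀, C₀, M₀, N₀, hδ₀, hC₀, hM₀, -, hfirst⟩ := prop22_first_multiLevelTorus d ℓ hℓ aminus aplus a2minus a2plus ha ha2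
  obtain ⟨δ₄, C₄, M₄, N₄, hδ₄, hC₄, hM₄, -, hfourth⟩ :=
    prop22_fourth_multiLevelTorus d ℓ hℓ aminus aplus a2minus a2plus ha ha2 α hα0 hα1
  have hL0 : (0 : ℝ) < (ℓ : ℝ) + 1 := by positivity
  -- the common rate
  obtain ⟨δ, hδ⟩ : ∃ δ : ℝ, δ = min (δ₀ / 2) (δ₄ / 2) := ⟨_, rfl⟩
  have hδpos : 0 < δ := by rw [hδ]; exact lt_min (by positivity) (by positivity)
  have hδ0' : δ ≤ δ₀ / 2 := by rw [hδ]; exact min_le_left _ _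
  have hδ4' : δ ≤ δ₄ / 2 := by rw [hδ]; exact min_le_right _ _
  -- the `k`-uniform (2.60)/(2.61) thresholds and constants at the rate `δ`
  obtain ⟨N₁, cK, hN₁, hcK0, hcon⟩ := consts_260_261 d ℓ hδpos
  have hap0 : 0 ≤ max aplus aminus := le_trans ha.le (le_max_right _ _)
  obtain ⟨KR, hKR⟩ : ∃ KR : ℝ, KR = 2 * C₀ * max aplus aminus * ((ℓ : ℝ) + 1) ^ 2 * Real.exp (3 / 2 * δ) * cK :=
    ⟨_, rfl⟩
  have hKR0 : 0 ≤ KR := by rw [hKR]; positivity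
  refine ⟨1 / 4 * δ, Real.sqrt (2 * C₄) * Real.sqrt (C₄ * KR) + 1, max M₀ M₄, max (max N₀ N₄) N₁, by positivity,
    by positivity, lt_of_lt_of_le hM₀ (le_max_left _ _), lt_of_lt_of_le hN₁ (le_max_right _ _), ?_⟩
  intro k Mh R hMh hM hR hRM P hP hP4 D D' a c haw hcw hac p q hpD hpD' hqD hqD' hp hq lam B hlam μ x x' hne hx hx'
  have hMh1 : 1 ≤ Mh := le_trans (by norm_num) hMh
  have hM0' : M₀ ≤ ((ℓ : ℝ) + 1) * Mh := le_trans (le_max_left _ _) hM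
  have hM4' : M₄ ≤ ((ℓ : ℝ) + 1) * Mh := le_trans (le_max_right _ _) hM
  have hRN0 : N₀ + 1 ≤ R * ((ℓ + 1) * Mh) :=
    le_trans (Nat.add_le_add_right ((le_max_left _ _).trans (le_max_left _ _)) 1) hRM
  have hRN4 : N₄ + 1 ≤ R * ((ℓ + 1) * Mh) :=
    le_trans (Nat.add_le_add_right ((le_max_right _ _).trans (le_max_left _ _)) 1) hRM
  have hRN1 : N₁ + 1 ≤ R * ((ℓ + 1) * Mh) := le_trans (Nat.add_le_add_right (le_max_right _ _) 1) hRM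
  have hRMone : 1 ≤ R * ((ℓ + 1) * Mh) := le_trans (by omega) hRN1
  obtain ⟨hthr, h261f⟩ := hcon k Mh R P hMh1 hP hRN1
  -- the weights with level `0` repaired; abbreviations
  obtain ⟨a', ha'0, ha'p, ha'1, ha'eq⟩ := weights_repair ha haw
  have hGm := hfirst k Mh R hMh hM0' hR hRN0 P hP hP4 D' a c haw hcw hac
  have hH := hfourth k Mh R hMh hM4' hR hRN4 P hP hP4 D a c haw hcw hac μ
  have hH' := hfourth k Mh R hMh hM4' hR hRN4 P hP hP4 D' a c haw hcw hac μ
  rw [gmlT_congr D' ha'eq] at hGm hH'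
  rw [gmlT_congr D ha'eq] at hH
  rw [gmlT_congr D ha'eq, gmlT_congr D' ha'eq]
  obtain ⟨G, hG⟩ : ∃ G, G = gmlT (N0 ℓ Mh k P) ℓ k D.lev a' := ⟨_, rfl⟩
  obtain ⟨G', hG'⟩ : ∃ G', G' = gmlT (N0 ℓ Mh k P) ℓ k D'.lev a' := ⟨_, rfl⟩
  rw [← hG] at hH ⊢
  rw [← hG'] at hGm hH' ⊢
  -- geometry of the common blocks
  have hB : 0 ≤ B := hlam.nonneg
  have hxD' : blkOf D'.toDomains x = ⟨p, hpD'⟩ := (blkOf_eq_iff_blkOf_eq D D' hpD hpD' x).1 hx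
  have hx'D' : blkOf D'.toDomains x' = ⟨p, hpD'⟩ := (blkOf_eq_iff_blkOf_eq D D' hpD hpD' x').1 hx'
  have hlevx : D.lev x.1 = k := by
    have h : (blkOf D.toDomains x).1.1 = p.1 := by rw [hx]
    exact h.trans hp
  have hlevx' : D'.lev x.1 = k := by
    have h : (blkOf D'.toDomains x).1.1 = p.1 := by rw [hxD']
    exact h.trans hp
  have hN1 : ∀ i, 1 ≤ N0 ℓ Mh k P i := one_le_N0 hMh1 hP
  have hc0 : 0 ≤ (torusSupNorm (N0 ℓ Mh k P) (x'.1 - x.1)) ^ (-α) :=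
    Real.rpow_nonneg (torusSupNorm_nonneg hN1 _) _
  have hm0 : 0 ≤ min ((geomT D).dist ⟨p, hpD⟩ ⟨q, hqD⟩) ((geomT D').dist ⟨p, hpD'⟩ ⟨q, hqD'⟩) :=
    le_min ((triangle_refl_nonneg_T D hMh1 hP).2.2 _ _) ((triangle_refl_nonneg_T D' hMh1 hP).2.2 _ _)
  have hdq : 0 ≤ (geomT D).dist ⟨p, hpD⟩ ⟨q, hqD⟩ := (triangle_refl_nonneg_T D hMh1 hP).2.2 _ _
  have hdq' : 0 ≤ (geomT D').dist ⟨p, hpD'⟩ ⟨q, hqD'⟩ := (triangle_refl_nonneg_T D' hMh1 hP).2.2 _ _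
  have hLk0 : 0 ≤ (((ℓ : ℝ) + 1) ^ k) ^ (1 - α) := Real.rpow_nonneg (by positivity) _
  -- the resolvent form of the difference
  have hsub : G - G' = G * diffM D D' a' * G' := by rw [hG, hG']; exact gmlT_sub_gmlT D D' a' hMh1 hP ha'1
  -- THE TRIVIAL BOUND
  have ht1 := hH ⟨q, hqD⟩ lam B hlam x x' hne (by rw [hx, hx'])
  rw [hx, hlevx] at ht1
  have ht2 := hH' ⟨q, hqD'⟩ lam B (blockSupp_transfer D D' hqD hqD' hlam) x x' hne (by rw [hxD', hx'D'])
  rw [hxD', hlevx'] at ht2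
  have hw₁ : Real.exp (-(δ₄ / 2 * (geomT D).dist ⟨p, hpD⟩ ⟨q, hqD⟩))
      ≤ Real.exp (-(δ * min ((geomT D).dist ⟨p, hpD⟩ ⟨q, hqD⟩) ((geomT D').dist ⟨p, hpD'⟩ ⟨q, hqD'⟩))) :=
    Real.exp_le_exp.2 (by nlinarith [min_le_left ((geomT D).dist ⟨p, hpD⟩ ⟨q, hqD⟩) ((geomT D').dist ⟨p, hpD'⟩ ⟨q, hqD'⟩)])
  have hw₂ : Real.exp (-(δ₄ / 2 * (geomT D').dist ⟨p, hpD'⟩ ⟨q, hqD'⟩))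
      ≤ Real.exp (-(δ * min ((geomT D).dist ⟨p, hpD⟩ ⟨q, hqD⟩) ((geomT D').dist ⟨p, hpD'⟩ ⟨q, hqD'⟩))) :=
    Real.exp_le_exp.2 (by nlinarith [min_le_right ((geomT D).dist ⟨p, hpD⟩ ⟨q, hqD⟩) ((geomT D').dist ⟨p, hpD'⟩ ⟨q, hqD'⟩)])
  have htriv : (torusSupNorm (N0 ℓ Mh k P) (x'.1 - x.1)) ^ (-α)
        * |(((G - G') *ᵥ lam) (tshift (N0 ℓ Mh k P) (unitVec μ) x') - ((G - G') *ᵥ lam) x'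
            - (((G - G') *ᵥ lam) (tshift (N0 ℓ Mh k P) (unitVec μ) x) - ((G - G') *ᵥ lam) x))|
      ≤ 2 * C₄ * ((((ℓ : ℝ) + 1) ^ k) ^ (1 - α) * B)
        * Real.exp (-(δ * min ((geomT D).dist ⟨p, hpD⟩ ⟨q, hqD⟩) ((geomT D').dist ⟨p, hpD'⟩ ⟨q, hqD'⟩))) := by
    have hsplit : ((G - G') *ᵥ lam) (tshift (N0 ℓ Mh k P) (unitVec μ) x') - ((G - G') *ᵥ lam) x'
          - (((G - G') *ᵥ lam) (tshift (N0 ℓ Mh k P) (unitVec μ) x) - ((G - G') *ᵥ lam) x)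
        = ((G *ᵥ lam) (tshift (N0 ℓ Mh k P) (unitVec μ) x') - (G *ᵥ lam) x'
            - ((G *ᵥ lam) (tshift (N0 ℓ Mh k P) (unitVec μ) x) - (G *ᵥ lam) x))
          - ((G' *ᵥ lam) (tshift (N0 ℓ Mh k P) (unitVec μ) x') - (G' *ᵥ lam) x'
            - ((G' *ᵥ lam) (tshift (N0 ℓ Mh k P) (unitVec μ) x) - (G' *ᵥ lam) x)) := by
      simp only [Matrix.sub_mulVec, Pi.sub_apply]; ring
    rw [hsplit]
    calc (torusSupNorm (N0 ℓ Mh k P) (x'.1 - x.1)) ^ (-α) * |_ - _|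
        ≤ (torusSupNorm (N0 ℓ Mh k P) (x'.1 - x.1)) ^ (-α)
            * (|(G *ᵥ lam) (tshift (N0 ℓ Mh k P) (unitVec μ) x') - (G *ᵥ lam) x'
                - ((G *ᵥ lam) (tshift (N0 ℓ Mh k P) (unitVec μ) x) - (G *ᵥ lam) x)|
              + |(G' *ᵥ lam) (tshift (N0 ℓ Mh k P) (unitVec μ) x') - (G' *ᵥ lam) x'
                - ((G' *ᵥ lam) (tshift (N0 ℓ Mh k P) (unitVec μ) x) - (G' *ᵥ lam) x)|) :=
          mul_le_mul_of_nonneg_left (abs_sub _ _) hc0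
      _ ≤ C₄ * (((ℓ : ℝ) + 1) ^ k) ^ (1 - α) * Real.exp (-(δ₄ / 2 * (geomT D).dist ⟨p, hpD⟩ ⟨q, hqD⟩)) * B
          + C₄ * (((ℓ : ℝ) + 1) ^ k) ^ (1 - α) * Real.exp (-(δ₄ / 2 * (geomT D').dist ⟨p, hpD'⟩ ⟨q, hqD'⟩)) * B := by
          rw [mul_add]; exact add_le_add ht1 ht2
      _ ≤ C₄ * (((ℓ : ℝ) + 1) ^ k) ^ (1 - α)
            * Real.exp (-(δ * min ((geomT D).dist ⟨p, hpD⟩ ⟨q, hqD⟩) ((geomT D').dist ⟨p, hpD'⟩ ⟨q, hqD'⟩))) * B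
          + C₄ * (((ℓ : ℝ) + 1) ^ k) ^ (1 - α)
            * Real.exp (-(δ * min ((geomT D).dist ⟨p, hpD⟩ ⟨q, hqD⟩) ((geomT D').dist ⟨p, hpD'⟩ ⟨q, hqD'⟩))) * B :=
          add_le_add (mul_le_mul_of_nonneg_right (mul_le_mul_of_nonneg_left hw₁ (by positivity)) hB)
            (mul_le_mul_of_nonneg_right (mul_le_mul_of_nonneg_left hw₂ (by positivity)) hB)
      _ = _ := by ring
  -- THE RESOLVENT BOUND through the Hölder functional of `G′[D]`
  have hψ : ∀ (b : ↥(bset D.toDomains)) (u : ↥(boxDom (N0 ℓ Mh k P)) → ℝ) (Bu : ℝ),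
      BlockSupp (g := geomT D) (blkOf D.toDomains) u b Bu →
      |quadFun (N0 ℓ Mh k P) G μ x x' ((torusSupNorm (N0 ℓ Mh k P) (x'.1 - x.1)) ^ (-α)) u|
        ≤ C₄ * (((ℓ : ℝ) + 1) ^ k) ^ (1 - α) * Real.exp (-(δ * (geomT D).dist ⟨p, hpD⟩ b)) * Bu := by
    intro b u Bu hu
    have h := hH b u Bu hu x x' hne (by rw [hx, hx'])
    rw [hx, hlevx] at h
    rw [abs_quadFun _ _ _ _ _ hc0]
    refine h.trans (mul_le_mul_of_nonneg_right (mul_le_mul_of_nonneg_left (Real.exp_le_exp.2 ?_) (by positivity))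
      hu.nonneg)
    have := (triangle_refl_nonneg_T D hMh1 hP).2.2 ⟨p, hpD⟩ b
    nlinarith
  have hR₁ := hasMajorant_rate_mono D' hMh1 hP (fun y => C₀ * ((ℓ : ℝ) + 1) ^ (2 * y.1.1)) (fun y => by positivity)
    hδ0' hGm
  have hR₂ : HasMajorant (g := geomT D') (blkOf D'.toDomains) (Matrix.toLin' (G' * 1))
      (fun y y' => C₀ * ((ℓ : ℝ) + 1) ^ (2 * y.1.1) * Real.exp (-(δ * (geomT D').dist y y'))) := by
    rw [Matrix.mul_one]; exact hR₁
  rw [hG'] at hR₂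
  have hres := fun_resolvent_bound D D' hMh1 hP hRMone ha'0 ha'p 2 1 hC₀.le hδpos.le
    (quadFun (N0 ℓ Mh k P) G μ x x' ((torusSupNorm (N0 ℓ Mh k P) (x'.1 - x.1)) ^ (-α))) (y := ⟨p, hpD⟩) hp
    (by positivity : 0 ≤ C₄ * (((ℓ : ℝ) + 1) ^ k) ^ (1 - α)) hψ hR₂ (h261f D) hthr (y' := ⟨q, hqD'⟩) hq
    (blockSupp_transfer D D' hqD hqD' hlam)
  rw [Matrix.mul_one, ← hG', ← hKR, div_self (by positivity : ((ℓ : ℝ) + 1) ^ (2 * k) ≠ 0), mul_one] at hres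
  -- identify the functional value with the Hölder quotient of the difference
  have hval : quadFun (N0 ℓ Mh k P) G μ x x' ((torusSupNorm (N0 ℓ Mh k P) (x'.1 - x.1)) ^ (-α))
        (diffM D D' a' *ᵥ (G' *ᵥ lam))
      = (torusSupNorm (N0 ℓ Mh k P) (x'.1 - x.1)) ^ (-α)
        * ((((G - G') *ᵥ lam) (tshift (N0 ℓ Mh k P) (unitVec μ) x') - ((G - G') *ᵥ lam) x')
            - (((G - G') *ᵥ lam) (tshift (N0 ℓ Mh k P) (unitVec μ) x) - ((G - G') *ᵥ lam) x)) := by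
    rw [quadFun_apply, hsub]
    simp only [Matrix.mulVec_mulVec, Matrix.mul_assoc]
  rw [hval, abs_mul, abs_of_nonneg hc0] at hres
  have h2 : (torusSupNorm (N0 ℓ Mh k P) (x'.1 - x.1)) ^ (-α)
        * |(((G - G') *ᵥ lam) (tshift (N0 ℓ Mh k P) (unitVec μ) x') - ((G - G') *ᵥ lam) x'
            - (((G - G') *ᵥ lam) (tshift (N0 ℓ Mh k P) (unitVec μ) x) - ((G - G') *ᵥ lam) x))|
      ≤ C₄ * KR * ((((ℓ : ℝ) + 1) ^ k) ^ (1 - α) * B) * Real.exp (-(1 / 2 * δ * dOmega D D' p.2 q.2)) := by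
    calc _ ≤ _ := hres
      _ = _ := by ring
  -- both factors at once
  have hfin := combined_bound (by positivity : (0 : ℝ) ≤ 2 * C₄) (by positivity : 0 ≤ C₄ * KR) (by positivity) htriv h2
  have hw3 : Real.exp (-(1 / 2 * δ * min ((geomT D).dist ⟨p, hpD⟩ ⟨q, hqD⟩) ((geomT D').dist ⟨p, hpD'⟩ ⟨q, hqD'⟩)))
      ≤ Real.exp (-(1 / 4 * δ * min ((geomT D).dist ⟨p, hpD⟩ ⟨q, hqD⟩) ((geomT D').dist ⟨p, hpD'⟩ ⟨q, hqD'⟩))) :=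
    Real.exp_le_exp.2 (by nlinarith)
  have hsq : Real.sqrt (2 * C₄) * Real.sqrt (C₄ * KR) ≤ Real.sqrt (2 * C₄) * Real.sqrt (C₄ * KR) + 1 := by linarith
  calc _ ≤ _ := hfin
    _ ≤ (Real.sqrt (2 * C₄) * Real.sqrt (C₄ * KR) + 1) * ((((ℓ : ℝ) + 1) ^ k) ^ (1 - α) * B)
          * Real.exp (-(1 / 4 * δ * min ((geomT D).dist ⟨p, hpD⟩ ⟨q, hqD⟩) ((geomT D').dist ⟨p, hpD'⟩ ⟨q, hqD'⟩)))
          * Real.exp (-(1 / 4 * δ * dOmega D D' p.2 q.2)) := by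
        refine mul_le_mul_of_nonneg_right ?_ (Real.exp_pos _).le
        exact mul_le_mul (mul_le_mul_of_nonneg_right hsq (by positivity)) hw3 (Real.exp_pos _).le (by positivity)
    _ = _ := by ring

end Holder

end

end Literature.MathematicalPhysics.QuantumFieldTheory.Balaban1983to89.B9Thm314GpFlatHolder
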